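import Literature.Analysis.FluidPDE.EulerReynoldsTorusPlanting
import HarnessLib

/-!
# The torus scaffold: a planted sink completion plus a stirring cell on `T³`

Analysis/FluidPDE support file (everything proved; no definitions, no named facts). Assembly of
`EulerReynoldsTorusPlantingFields` and `EulerReynoldsTorusPlanting` into one existence statement,
`exists_eulerReynolds_torusScaffold`: given, on `ℝ³`, a sink completion `(r₀, r₁, c, U, R)` of a
germ `V` with `r₁ ≤ 1/16` (germ on `0 < |x| < r₀`, rest state `(0, c·Id)` outside `B_{r₁}`, smooth
collar with `R ≻ 0`, `U ∈ L²`, `R ∈ L¹(B_{r₁})`, `U` weakly divergence free, weak stationary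
Euler–Reynolds identity against divergence-free tests off the origin) and a stirring cell
`(W, S, f)` at level `c` supported in `B(p, 1/16)`, `p = (⅛, ½, ½)` (smooth, `div W = div f = 0`,
`c·Id + S ≻ 0`, weak identity with source for all compactly supported tests, power
`∫ ⟪f, W⟫ = D`), there are a sink `x₀ ∈ T³` and fields `f', U', R'` on `T³` forming the scaffold
of the point-sink construction with power `D` (the eleven clauses of
`Summits/AnomalousDissipation`, crux `PointSink.SolitonTransplant`, stub `tunedTorusPlanting`):
`x₀ = proj (½,½,½)`, `U' = periodize (U(· − q) + W)`, `R' = c·Id + periodize ((R(· − q) − c·Id) + S)`,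
`f' = periodize f`.

## References

* C. De Lellis, L. Székelyhidi Jr., Arch. Ration. Mech. Anal. 195 (2010), §2 (subsolutions).
* E. Bruè, C. De Lellis, Comm. Math. Phys. 400 (2023), §5 (cube-supported fields on the torus).
-/

noncomputable section

open MeasureTheory Set Function Filter Metric TopologicalSpace
open scoped RealInnerProductSpace ContDiff Topology
open Literature.Analysis.FunctionSpaces

namespace Literature.Analysis.FluidPDE

/-- **The torus scaffold.** From a sink completion `(r₀, r₁, c, U, R)` of the germ `V` on `ℝ³`
(`r₁ ≤ 1/16`) and a stirring cell `(W, S, f)` at level `c` in `B(p, 1/16)`, `p = (⅛, ½, ½)`, with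
power `D`: a sink `x₀ ∈ T³`, radii `r₀ < r₁ ≤ 1/4`, and fields `f', U', R'` on `T³` such that `f'`
is smooth, divergence free, mean zero and vanishes on the chart ball of radius `r₁` at `x₀`;
`U' = V` on the punctured germ ball and `R' = 0` on the closed germ ball (in the chart
`v ↦ x₀ + proj v`); `U', R'` are smooth and `R' ≻ 0` at chart points farther than `r₀` from the
lattice; `U' ∈ L²(T³)`, `R' ∈ L¹(T³)`, `U'` weakly divergence free; the weak Euler–Reynolds
identity with source `f'` holds against smooth divergence-free torus tests vanishing near `x₀`;
and `∫ ⟪f', U'⟫ = D`. [folklore] -/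
theorem exists_eulerReynolds_torusScaffold (q p : EuclideanSpace ℝ (Fin 3)) (hq : ∀ i, q i = 1 / 2)
    (hp : ∀ i, p i = if i = 0 then 1 / 8 else 1 / 2)
    (V U : EuclideanSpace ℝ (Fin 3) → EuclideanSpace ℝ (Fin 3))
    (R : EuclideanSpace ℝ (Fin 3) → Fin 3 → Fin 3 → ℝ) (r₀ r₁ c : ℝ)
    (hr : 0 < r₀ ∧ r₀ < r₁ ∧ r₁ ≤ 1 / 16)
    (hgerm : ∀ x : EuclideanSpace ℝ (Fin 3), 0 < ‖x‖ → ‖x‖ < r₀ → U x = V x)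
    (hR0 : ∀ x : EuclideanSpace ℝ (Fin 3), ‖x‖ ≤ r₀ → R x = 0)
    (hrest : ∀ x : EuclideanSpace ℝ (Fin 3), r₁ ≤ ‖x‖ →
      U x = 0 ∧ R x = fun i j => if i = j then c else 0)
    (hUs : ContDiffOn ℝ ∞ U {x : EuclideanSpace ℝ (Fin 3) | r₀ < ‖x‖})
    (hRs : ContDiffOn ℝ ∞ R {x : EuclideanSpace ℝ (Fin 3) | r₀ < ‖x‖})
    (hpos : ∀ x : EuclideanSpace ℝ (Fin 3), r₀ < ‖x‖ → (Matrix.of (R x)).PosDef)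
    (hint : MemLp U 2 volume ∧ IntegrableOn R (ball (0 : EuclideanSpace ℝ (Fin 3)) r₁) volume)
    (hwdiv : ∀ θ : EuclideanSpace ℝ (Fin 3) → ℝ, ContDiff ℝ ∞ θ → HasCompactSupport θ →
      ∫ x, ⟪U x, gradient θ x⟫ = 0)
    (hweak : ∀ w : EuclideanSpace ℝ (Fin 3) → EuclideanSpace ℝ (Fin 3),
      IsTestFunctionOn ⟨{x : EuclideanSpace ℝ (Fin 3) | x ≠ 0}, isOpen_ne⟩ w →
      (∀ x, VectorCalculus.divergence w x = 0) →
      ∫ x, (⟪U x, fderiv ℝ w x (U x)⟫ +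
        ∑ i, ∑ j, R x i j * fderiv ℝ w x (EuclideanSpace.single j 1) i) = 0)
    (W f : EuclideanSpace ℝ (Fin 3) → EuclideanSpace ℝ (Fin 3))
    (S : EuclideanSpace ℝ (Fin 3) → Fin 3 → Fin 3 → ℝ)
    (hW : ContDiff ℝ ∞ W) (hf : ContDiff ℝ ∞ f) (hS : ContDiff ℝ ∞ S)
    (hWs : tsupport W ⊆ ball p (1 / 16)) (hfs : tsupport f ⊆ ball p (1 / 16))
    (hSs : tsupport S ⊆ ball p (1 / 16))
    (hWdiv : ∀ x, VectorCalculus.divergence W x = 0) (hfdiv : ∀ x, VectorCalculus.divergence f x = 0)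
    (hScell : ∀ x, (Matrix.of fun i j => (if i = j then c else 0) + S x i j).PosDef)
    (hcell : ∀ φ : EuclideanSpace ℝ (Fin 3) → EuclideanSpace ℝ (Fin 3), ContDiff ℝ ∞ φ →
      HasCompactSupport φ →
      ∫ x, (⟪W x, fderiv ℝ φ x (W x)⟫ +
        ∑ i, ∑ j, S x i j * fderiv ℝ φ x (EuclideanSpace.single j 1) i + ⟪f x, φ x⟫) = 0)
    (D : ℝ) (hpower : ∫ x, ⟪f x, W x⟫ = D) :
    ∃ (x₀ : UnitAddTorus (Fin 3)) (r₀' r₁' : ℝ)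
      (f' U' : UnitAddTorus (Fin 3) → EuclideanSpace ℝ (Fin 3))
      (R' : UnitAddTorus (Fin 3) → Fin 3 → Fin 3 → ℝ),
      (0 < r₀' ∧ r₀' < r₁' ∧ r₁' ≤ 1 / 4) ∧
      (Torus.IsSmooth f' ∧ Torus.IsDivFree f' ∧ Torus.HasZeroMean f') ∧
      (∀ v : EuclideanSpace ℝ (Fin 3), ‖v‖ < r₁' → Torus.liftAt f' x₀ v = 0) ∧
      (∀ v : EuclideanSpace ℝ (Fin 3), 0 < ‖v‖ → ‖v‖ < r₀' → Torus.liftAt U' x₀ v = V v) ∧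
      (∀ v : EuclideanSpace ℝ (Fin 3), ‖v‖ ≤ r₀' → Torus.liftAt R' x₀ v = 0) ∧
      ContDiffOn ℝ ∞ (Torus.liftAt U' x₀)
        {v : EuclideanSpace ℝ (Fin 3) | ∀ w : EuclideanSpace ℝ (Fin 3), Torus.proj w = 0 →
          r₀' < ‖v - w‖} ∧
      ContDiffOn ℝ ∞ (Torus.liftAt R' x₀)
        {v : EuclideanSpace ℝ (Fin 3) | ∀ w : EuclideanSpace ℝ (Fin 3), Torus.proj w = 0 →
          r₀' < ‖v - w‖} ∧
      (∀ v : EuclideanSpace ℝ (Fin 3), (∀ w : EuclideanSpace ℝ (Fin 3), Torus.proj w = 0 →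
          r₀' < ‖v - w‖) → (Matrix.of (Torus.liftAt R' x₀ v)).PosDef) ∧
      (MemLp U' 2 volume ∧ Integrable R' volume ∧ Torus.IsWeaklyDivFree U') ∧
      (∀ w : UnitAddTorus (Fin 3) → EuclideanSpace ℝ (Fin 3), Torus.IsSmooth w →
        Torus.IsDivFree w →
        (∃ δ : ℝ, 0 < δ ∧ ∀ v : EuclideanSpace ℝ (Fin 3), ‖v‖ < δ → Torus.liftAt w x₀ v = 0) →
        ∫ x, (⟪U' x, Torus.convect U' w x⟫ +
          ∑ i, ∑ j, R' x i j * Torus.partialDeriv j w x i + ⟪f' x, w x⟫) = 0) ∧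
      ∫ x, ⟪f' x, U' x⟫ = D := by
  obtain ⟨hr₀, hr₀₁, hr₁⟩ := hr
  have hr₁pos : 0 < r₁ := hr₀.trans hr₀₁
  set Uc : EuclideanSpace ℝ (Fin 3) → EuclideanSpace ℝ (Fin 3) := fun y => U (y - q) + W y with hUc
  set Sc : EuclideanSpace ℝ (Fin 3) → Fin 3 → Fin 3 → ℝ :=
    fun y i j => (R (y - q) i j - if i = j then c else 0) + S y i j with hSc
  obtain ⟨hUc0, hSc0, hf0⟩ :=
    cubeFields_eq_zero_of_not_mem_openCube hq hp hr₁ hrest hWs hfs hSs hUc hSc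
  -- supports and the cell ball
  have hK : closedBall p (1 / 16) ⊆ {y : EuclideanSpace ℝ (Fin 3) | ∀ i, y i ∈ Ioo (0 : ℝ) 1} :=
    closedBall_cellCentre_subset_openCube hp
  have hfK : ∀ y ∉ closedBall p (1 / 16), f y = 0 := fun y hy =>
    image_eq_zero_of_notMem_tsupport fun h => hy (hfs.trans ball_subset_closedBall h)
  have hfsupp : tsupport f ⊆ closedBall 0 (Fintype.card (Fin 3) : ℝ) :=
    Torus.tsupport_subset_closedBall_of_openCube ((hfs.trans ball_subset_closedBall).trans hK)
  have hUcsupp : support Uc ⊆ closedBall 0 (Fintype.card (Fin 3) : ℝ) :=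
    Torus.support_subset_closedBall_of_cube hUc0
  have hScsupp : support Sc ⊆ closedBall 0 (Fintype.card (Fin 3) : ℝ) :=
    Torus.support_subset_closedBall_of_cube hSc0
  -- the torus force
  have hfsm : Torus.IsSmooth (Torus.periodize f) := Torus.isSmooth_periodize hf hfsupp
  have hfdivT : Torus.IsDivFree (Torus.periodize f) :=
    Torus.isDivFree_periodize_of_cube hf isClosed_closedBall hK hfK hfdiv
  -- the charts at `x₀ = proj q`
  have hUlift : Torus.liftAt (Torus.periodize Uc) (Torus.proj q) = fun v => Torus.perSum Uc (q + v) :=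
    Torus.liftAt_periodize_proj Uc q
  have hflift : Torus.liftAt (Torus.periodize f) (Torus.proj q) = fun v => Torus.perSum f (q + v) :=
    Torus.liftAt_periodize_proj f q
  have hRlift : Torus.liftAt (fun x i j => (if i = j then c else 0) + Torus.periodize Sc x i j)
      (Torus.proj q) = fun v i j => (if i = j then c else 0) + Torus.perSum Sc (q + v) i j := by
    funext v i j
    rw [Torus.liftAt_apply, ← Torus.proj_add, Torus.periodize_proj]
  refine ⟨Torus.proj q, r₀, r₁, Torus.periodize f, Torus.periodize Uc,
    fun x i j => (if i = j then c else 0) + Torus.periodize Sc x i j,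
    ⟨hr₀, hr₀₁, by linarith⟩, ⟨hfsm, hfdivT, ?_⟩, fun v hv => ?_, fun v hv0 hv => ?_, fun v hv => ?_,
    ?_, ?_, fun v hv => ?_, ⟨?_, ?_, ?_⟩, fun w hw hwd hw0 => ?_, ?_⟩
  · -- zero mean
    refine Torus.hasZeroMean_of_isDivFree_of_forall_eq_zero hfsm hfdivT
      (isCompact_closedBall p (1 / 16)) hK fun y hy hyK => ?_
    rw [Torus.periodize_proj, Torus.perSum_eq_self_of_mem_unitCube hf0 hy]
    exact hfK y hyK
  · -- the force vanishes on the chart ball of radius `r₁`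
    rw [hflift]
    exact (cubeFields_apply_centre_add hq hp hr₁ hrest hWs hfs hSs hUc hSc
      (hv.trans_le (by linarith))).2.2
  · -- the germ
    rw [hUlift]
    simp only
    rw [(cubeFields_apply_centre_add hq hp hr₁ hrest hWs hfs hSs hUc hSc
      (hv.trans_le (by linarith))).1]
    exact hgerm v hv0 hv
  · -- the stress vanishes on the closed germ ball
    rw [hRlift]
    simp only
    rw [(cubeFields_apply_centre_add hq hp hr₁ hrest hWs hfs hSs hUc hSc
      (hv.trans_lt (by linarith))).2.1, hR0 v hv]
    funext i j
    simp
  · -- smoothness of the planted velocity off the germ balls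
    rw [hUlift]
    exact Torus.contDiffOn_perSum_comp_add hUcsupp q
      (contDiffOn_cubeVelocity_translate hUs hW hUc)
  · -- smoothness of the planted stress off the germ balls
    rw [hRlift]
    exact contDiffOn_const.add (Torus.contDiffOn_perSum_comp_add hScsupp q
      (contDiffOn_cubeStress_translate hRs hS hSc))
  · -- positivity off the germ balls
    rw [hRlift]
    exact posDef_cubeStress_perSum hq hp hr₁ hrest hpos hWs hfs hSs hScell hUc hSc hv
  · -- square integrability
    exact Torus.memLp_periodize_of_cube hUc0 (memLp_cubeVelocity hint.1 hW hWs hUc)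
  · -- integrability of the stress
    exact (integrable_const _).add (Torus.integrable_periodize_of_cube hSc0
      (integrable_cubeStress hrest hint.2 hS hSs hSc))
  · -- weak divergence-freeness
    exact isWeaklyDivFree_periodize_cubeVelocity hq hp hr₁pos hr₁ hrest hwdiv hW hWs hfs hSs hWdiv
      hUc hSc
  · -- the weak Euler–Reynolds identity with source
    exact integral_eulerReynolds_periodize_eq_zero hq hp hr₁pos hr₁ hrest hweak hW hf hS hWs hfs hSs
      hcell hUc hSc w hw hwd hw0
  · -- the power
    rw [integral_inner_periodize_eq hq hp hr₁ hrest hWs hfs hSs hUc hSc, hpower]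

end Literature.Analysis.FluidPDE
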